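import Summits.AtomisticToContinuum.Crystallization.Theses.ThreeConeCertificate
import Summits.AtomisticToContinuum.Crystallization.Theses.PhononSlackCertificates
import Summits.AtomisticToContinuum.Crystallization.Theses.PalmUnimodularRigidity
import Summits.AtomisticToContinuum.Crystallization.Theorems.ThreeConeCertificateSlackRigidityOfPalmRigidity
import Summits.AtomisticToContinuum.Crystallization.Theorems.PalmUnimodularRigidityCruxesToPalmRigidity
import Summits.AtomisticToContinuum.Crystallization.Theorems.MinimiserShells.Negative.LoadBearing
import Summits.AtomisticToContinuum.Crystallization.Theorems.ThreeConeCertificateSlackRigidityPricedFloorsDefs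
import Summits.AtomisticToContinuum.Crystallization.Theorems.ThreeConeCertificateSlackRigidityPricedFloorsSelection
import Summits.AtomisticToContinuum.Crystallization.Theorems.ThreeConeCertificateSlackRigidityPricedFloorsApplication
import Summits.AtomisticToContinuum.Crystallization.Theorems.ThreeConeCertificateSlackRigidityPricedFloorsSandwich
import Summits.AtomisticToContinuum.Crystallization.Theorems.ThreeConeCertificateSlackRigidityPricedFloorsExactify
import Summits.AtomisticToContinuum.Crystallization.Theorems.ThreeConeCertificateSlackRigidityPricedFloorsGlobalize
import Summits.AtomisticToContinuum.Crystallization.Theorems.ThreeConeCertificateSlackRigidityPricedFloorsFinal4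
import Literature.Probability.Process.LocallyMatches
import Literature.Probability.Process.PointStationaryLaw
import Literature.MathematicalPhysics.StatisticalMechanics.RootEnergy
import Literature.MathematicalPhysics.StatisticalMechanics.BarlowStacking
import HarnessLib

/-!
# `SlackRigidity` (stmt-AtomisticToContinuum-11960), line `priced-floors-palm-exactification`:
# THE CRUX REDUCED TO THE TWO PRICED INEQUALITIES (conditional crux, sorry-free)

Lead c19.  Every stub of the line except `stub_pricedInequalities` (= items
stmt-AtomisticToContinuum-13956 `CoerciveTwoShellGap` and stmt-AtomisticToContinuum-13958
`NearFieldConvexity` of route `PhononSlackCertificates`, open) has LANDED; this file composes them: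

* `lms_palmRigidity_of_pricedInequalities : CoerciveTwoShellGap → NearFieldConvexity → PalmRigidity`
  (the crux of route `PalmUnimodularRigidity`, item 9224, CONDITIONALLY), and
* `lms_slackRigidity_of_pricedInequalities : CoerciveTwoShellGap → NearFieldConvexity → SlackRigidity`
  (THIS crux, conditionally), through the landed closure
  `EkelandSurgeryParityClosure.slackRigidity_of_palmRigidity`.

Composition (all landed): cluster selection (`…PricedFloorsSelection`), layered sandwich
(`…Sandwich`), floors application (`…Application`), root-to-everywhere
(`PalmUnimodularRigidity.ae_forall_map_sub_of_ae`), exactification (`…Exactify`), local-to-global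
(`…Globalize`), selection in mean (`…Final4`).  `[folklore]` glue.
-/

noncomputable section

open MeasureTheory Filter Set
open scoped ENNReal BigOperators Topology

namespace Summit.AtomisticToContinuum.Crystallization.Theorems.SlackRigidityPricedFloorsReduction

open Literature.Probability.Process
open Literature.MathematicalPhysics.StatisticalMechanics
open Summit.AtomisticToContinuum.Crystallization.Theses.ThreeConeCertificate (SlackRigidity)
open Summit.AtomisticToContinuum.Crystallization.Theses.PalmUnimodularRigidity (PalmRigidity)
open Summit.AtomisticToContinuum.Crystallization.Theses.PhononSlackCertificates
  (CoerciveTwoShellGap NearFieldConvexity)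
open Summit.AtomisticToContinuum.Crystallization.Theorems
open Summit.AtomisticToContinuum.Crystallization.Theorems.MinimiserShells.Negative.LoadBearing (eStar)
open Summit.AtomisticToContinuum.Crystallization.Theorems.SlackRigidityPricedFloors

/-- **S1 composed**: engine + sandwich + application + root-to-everywhere give, for a minimising
point-stationary hard-core law, almost surely EVERY point `η`-layered (radii `2, 19/10`) for every
`η > 0`. -/
theorem floorsToLaw_of
    (hsel : ∀ δ : ℝ, 0 < δ → ∀ P : Measure (Measure E3), IsProbabilityMeasure P → IsMinimisingLaw δ P →
      ∀ G : Set (Measure E3), MeasurableSet G → P Gᶜ ≠ 0 → ClusterSelectionFor δ G)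
    (hsand : ∀ δ η : ℝ, 0 < δ → 0 < η → ∃ G : Set (Measure E3), MeasurableSet G ∧
      (∀ μ : Measure E3, IsRootedHardCore δ μ → μ ∈ G → LayeredAt 2 (19 / 10) η (atoms μ) 0) ∧
      (∀ μ : Measure E3, IsRootedHardCore δ μ → LayeredAt 2 2 (η / 2) (atoms μ) 0 → μ ∈ G))
    (happ : CoerciveTwoShellGap → NearFieldConvexity → ∀ δ : ℝ, 0 < δ → ∀ P : Measure (Measure E3),
      IsProbabilityMeasure P → IsMinimisingLaw δ P →
      (∀ G : Set (Measure E3), MeasurableSet G → P Gᶜ ≠ 0 → ClusterSelectionFor δ G) →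
      ∀ η : ℝ, 0 < η → ∀ G : Set (Measure E3), MeasurableSet G →
      (∀ μ : Measure E3, IsRootedHardCore δ μ → LayeredAt 2 2 η (atoms μ) 0 → μ ∈ G) → P Gᶜ = 0)
    (h56 : CoerciveTwoShellGap) (h58 : NearFieldConvexity)
    {δ : ℝ} (hδ : 0 < δ) (P : Measure (Measure E3)) [hP : IsProbabilityMeasure P]
    (hlaw : IsMinimisingLaw δ P) :
    ∀ᵐ μ ∂P, ∀ y ∈ atoms μ, ∀ η : ℝ, 0 < η → LayeredAt 2 (19 / 10) η (atoms μ) y := by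
  -- Step 1: for each `n`, a.s. the ROOT is `1/(n+1)`-layered with radii `(2, 19/10)`
  have hroot : ∀ n : ℕ, ∀ᵐ μ ∂P, LayeredAt 2 (19 / 10) (1 / ((n : ℝ) + 1)) (atoms μ) 0 := by
    intro n
    have hη : (0 : ℝ) < 1 / ((n : ℝ) + 1) := by positivity
    obtain ⟨G, hGm, hGup, hGlow⟩ := hsand δ (1 / ((n : ℝ) + 1)) hδ hη
    have hPG : P Gᶜ = 0 :=
      happ h56 h58 δ hδ P hP hlaw (hsel δ hδ P hP hlaw) (1 / ((n : ℝ) + 1) / 2) (by positivity) G hGm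
        (fun μ hc hl => hGlow μ hc hl)
    have hae : ∀ᵐ μ ∂P, μ ∈ G := by
      rw [ae_iff]
      simpa only [Set.compl_def] using hPG
    filter_upwards [hae, hlaw.1] with μ hμ hc
    exact hGup μ hc hμ
  -- Step 2: root ⇒ every point (mass transport), then all `η` by monotonicity
  have hall : ∀ᵐ μ ∂P, ∀ n : ℕ, LayeredAt 2 (19 / 10) (1 / ((n : ℝ) + 1)) (atoms μ) 0 :=
    ae_all_iff.2 hroot
  have hlf : ∀ᵐ μ ∂P, ∀ n : ℕ, μ ((fun z : E3 => ⌊‖z‖⌋₊) ⁻¹' {n}) < ⊤ := by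
    filter_upwards [hlaw.1] with μ hc n
    obtain ⟨S, -, hsep, rfl⟩ := hc
    exact PalmUnimodularRigidity.count_restrict_floorNorm_preimage_lt_top hδ hsep n
  have hev := PalmUnimodularRigidity.ae_forall_map_sub_of_ae hlaw.2.1 hlf hall
  filter_upwards [hev] with μ hμ y hy η hη
  obtain ⟨n, hn⟩ := exists_nat_one_div_lt hη
  have h1 := (layeredAt_atoms_map_sub_iff 2 (19 / 10) (1 / ((n : ℝ) + 1)) μ y).1 (hμ y hy n)
  exact h1.mono le_rfl le_rfl hn.le

/-- **S2 composed**: exactification at every point + the exact local-to-global lemma. -/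
theorem exactLayeredGlobal_of
    (hex : ∀ δ : ℝ, 0 < δ → ∀ S : Set E3, (∀ x ∈ S, ∀ y ∈ S, x ≠ y → δ ≤ dist x y) →
      ∀ y ∈ S, (∀ η : ℝ, 0 < η → LayeredAt 2 (19 / 10) η S y) → ExactLayeredAt S y)
    (hglob : ∀ δ : ℝ, 0 < δ → ∀ S : Set E3, (0 : E3) ∈ S → (∀ x ∈ S, ∀ y ∈ S, x ≠ y → δ ≤ dist x y) →
      (∀ y ∈ S, ExactLayeredAt S y) → GlobalLayered S)
    {δ : ℝ} (hδ : 0 < δ) (S : Set E3) (h0 : (0 : E3) ∈ S)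
    (hsep : ∀ x ∈ S, ∀ y ∈ S, x ≠ y → δ ≤ dist x y)
    (hlay : ∀ y ∈ S, ∀ η : ℝ, 0 < η → LayeredAt 2 (19 / 10) η S y) : GlobalLayered S :=
  hglob δ hδ S h0 hsep fun y hy => hex δ hδ S hsep y hy (hlay y hy)

/-- **Item 9224 from the stubs**: floors ⇒ a.s. everywhere `∀η`-layered ⇒ globally exactly layered ⇒
mean Hägg selection proves `PalmRigidity` (route `PalmUnimodularRigidity`'s target) itself.  Sorry-free;
the hypotheses are the seven stub statements. -/
theorem PalmRigidity_of_stubs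
    (h0 : CoerciveTwoShellGap ∧ NearFieldConvexity)
    (hsel : ∀ δ : ℝ, 0 < δ → ∀ P : Measure (Measure E3), IsProbabilityMeasure P → IsMinimisingLaw δ P →
      ∀ G : Set (Measure E3), MeasurableSet G → P Gᶜ ≠ 0 → ClusterSelectionFor δ G)
    (hsand : ∀ δ η : ℝ, 0 < δ → 0 < η → ∃ G : Set (Measure E3), MeasurableSet G ∧
      (∀ μ : Measure E3, IsRootedHardCore δ μ → μ ∈ G → LayeredAt 2 (19 / 10) η (atoms μ) 0) ∧
      (∀ μ : Measure E3, IsRootedHardCore δ μ → LayeredAt 2 2 (η / 2) (atoms μ) 0 → μ ∈ G))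
    (happ : CoerciveTwoShellGap → NearFieldConvexity → ∀ δ : ℝ, 0 < δ → ∀ P : Measure (Measure E3),
      IsProbabilityMeasure P → IsMinimisingLaw δ P →
      (∀ G : Set (Measure E3), MeasurableSet G → P Gᶜ ≠ 0 → ClusterSelectionFor δ G) →
      ∀ η : ℝ, 0 < η → ∀ G : Set (Measure E3), MeasurableSet G →
      (∀ μ : Measure E3, IsRootedHardCore δ μ → LayeredAt 2 2 η (atoms μ) 0 → μ ∈ G) → P Gᶜ = 0)
    (hex : ∀ δ : ℝ, 0 < δ → ∀ S : Set E3, (∀ x ∈ S, ∀ y ∈ S, x ≠ y → δ ≤ dist x y) →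
      ∀ y ∈ S, (∀ η : ℝ, 0 < η → LayeredAt 2 (19 / 10) η S y) → ExactLayeredAt S y)
    (hglob : ∀ δ : ℝ, 0 < δ → ∀ S : Set E3, (0 : E3) ∈ S → (∀ x ∈ S, ∀ y ∈ S, x ≠ y → δ ≤ dist x y) →
      (∀ y ∈ S, ExactLayeredAt S y) → GlobalLayered S)
    (h3 : ∀ δ : ℝ, 0 < δ → ∀ P : Measure (Measure E3), IsProbabilityMeasure P → IsMinimisingLaw δ P →
      (∀ᵐ μ ∂P, GlobalLayered (atoms μ)) → ∀ᵐ μ ∂P, IsOptimalHcpSample μ) :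
    PalmRigidity := by
  intro δ hδ P hP hcore hstat hE
  have hlaw : IsMinimisingLaw δ P := ⟨hcore, hstat, hE⟩
  have hlay := floorsToLaw_of hsel hsand happ h0.1 h0.2 hδ P hlaw
  have hglobal : ∀ᵐ μ ∂P, GlobalLayered (atoms μ) := by
    filter_upwards [hlay, hlaw.1] with μ hμ hc
    obtain ⟨S, h0S, hsep, rfl⟩ := hc
    rw [atoms_count_restrict] at hμ ⊢
    exact exactLayeredGlobal_of hex hglob hδ S h0S hsep hμ
  exact h3 δ hδ P hP hlaw hglobal


/-- **`PalmRigidity` from the two priced inequalities** (registered sub-goal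
`lms_palmRigidity_of_pricedInequalities`): item 9224's statement, conditionally. [folklore] -/
theorem lms_palmRigidity_of_pricedInequalities : CoerciveTwoShellGap → NearFieldConvexity → PalmRigidity :=
  fun h56 h58 => PalmRigidity_of_stubs ⟨h56, h58⟩
    SlackRigidityPricedFloorsSelection.stub_clusterSelection
    SlackRigidityPricedFloorsSandwich.stub_layeredSandwich
    SlackRigidityPricedFloorsApplication.stub_floorsApplication
    SlackRigidityPricedFloorsExactify.stub_exactify
    SlackRigidityPricedFloorsGlobalize.stub_globalize
    SlackRigidityPricedFloorsFinal.stub_layeredMeanSelection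

/-- **The crux `SlackRigidity` from the two priced inequalities** (registered sub-goal
`lms_slackRigidity_of_pricedInequalities`). [folklore] -/
theorem lms_slackRigidity_of_pricedInequalities : CoerciveTwoShellGap → NearFieldConvexity → SlackRigidity :=
  fun h56 h58 => EkelandSurgeryParityClosure.slackRigidity_of_palmRigidity
    (lms_palmRigidity_of_pricedInequalities h56 h58)

end Summit.AtomisticToContinuum.Crystallization.Theorems.SlackRigidityPricedFloorsReduction

end
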